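import Summits.AnomalousDissipation.AnomalousDissipation.Theorems.SolenoidalFractalHomogenisationLagrangianStepCellClauseCuts

/-!
# K1L `LagrangianRenormalisationStep` — STUB-IDEAS for `stub_cellLawV` (skeleton v21): the two NEW typed helper statements
(planner ad-ideate-p5 g6, lens «profile»; companion of `STUB-IDEAS-stub_cellLawV-p5.md`; Props only — nothing proved, no `sorry`,
no axioms; elaborates against the tree's `…Theorems.SolenoidalFractalHomogenisationLagrangianStepCellClauseCuts`).

`stub_cellLawV` (v21, XL, unowned) = `IsotropicWordGain W c₀ → ScalarLawBlock W c₀ → ∃ M c Φ lo hi Λ β, WindowClause Φ lo hi Λ β ∧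
∃ σ C ν₀ K, SlowVectorClauseNoEx W M hM c Φ lo hi Λ β σ C ν₀ K`.  It splits into two packages with disjoint difficulty:

* **(W) WINDOW half** — finite-dimensional: `Φ := N⁻¹·G_{W,M}` (the normalised EXACT finite-`M` quasi-static response: `excQS + pairQS +`
  the finitely many non-mixing chains), `β = 0`, reciprocal band `[a^{-1/2}, a^{1/2}]`.  Typed already (crux workfile
  `LoewnerWindowSketch.lean`, idea `loewner-reflected-window`): S0 `SlotWeightMono`, S2 `QSPinch`, S3 `QSWindow`, S3′ `QSWindowPerturbed`,
  S6 `CubatureThreshold`, S7 `CubatureWindowClause`.  NEW here: `IsoTwoTermThreshold` — the crossing `gainSup(lo) < gainInf(hi)` for EVERY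
  isotropic word above an explicit aspect threshold `a⋆(W) = √(sup F₂ / inf F₂)`, `F₂ = Σ_s slotGain_s/T_s²` (the general-`W` form of S6;
  what makes the stub's `∀ W` plausible: isotropy forces `inf F₂ > 0`).
* **(V) SLOW-VECTOR half** — the PDE package: Fourier reduction of every weak cell solution to the Bloch-sector coefficient system
  (`Literature.…PassiveVectorTensorGalerkinIdentity/ModeEnergy/Uniqueness`), the slow graph with `L(0) = 0` (G1 `RiccatiInvariantBall` + G2
  `GraphReduction` of `SlowGraphSketch.lean`; NO Duhamel remainder is needed for (V): the single-mode datum lies on the graph), the PERIOD-MEAN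
  IDENTIFICATION of the graph term with `−4π²(|ℓ|²/n²)·(c/ν)Φ(𝔸/ν)` up to the relative rate error `e = C(ν^σ + ϖ^σ)` (chain sum; the one
  PDE-mixing input is the foreign-slot decorrelation, crux idea `foreign-slot-hypocoercive-ladder`, `ForeignSlotHypocoerciveLadderSketch.FirstLemma`),
  and NEW here: `DecayRelativeAveragingB` (v3: WITH the a-priori energy bound `hB`, after ad-lit L24-1) — the finite-dimensional linear averaging lemma that turns "period means of the slow generator are
  `(1 ± e)`×constant, oscillation `≤ r̄` within periods of length `P`" into EXACTLY the error structure `C·(e·min(1, r̄t) + r̄P)·√E₀` of clause (V).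
-/

set_option linter.dupNamespace false -- layout D-0017: `AnomalousDissipation.AnomalousDissipation` is intended

namespace Summit.AnomalousDissipation.AnomalousDissipation.Cruxes.LagrangianRenormalisationStep.CellLawVPlan

open Real MeasureTheory Set Filter Matrix
open scoped BigOperators

noncomputable section

/-- Unit transverse pairs `(q, p)`: `|q| = |p| = 1`, `p ⊥ q` (as in `LoewnerWindowSketch.transversePairs`). -/
def transversePairs : Set ((Fin 3 → ℝ) × (Fin 3 → ℝ)) :=
  {qp | ∑ i, qp.1 i ^ 2 = 1 ∧ ∑ i, qp.2 i ^ 2 = 1 ∧ ∑ i, qp.2 i * qp.1 i = 0}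

/-! ## (W) the general-word crossing -/

/-- **(W-T2) Isotropic two-term threshold — every isotropic word** (M; calculus on a compact set).  Abstract slot data: finitely many
transverse slot forms `w s q p ≥ 0`, continuous, with ISOTROPIC sum `Σ_s w s q p = G₀ > 0` on unit transverse pairs (for a lattice word:
`w s = slotGainC (W.phase s)`, `G₀ = c₀·period`, `IsotropicWordGain W c₀`), unit-stretch relaxations `T₁ s > 0` (`T_s = M·T₁ s`,
`T₁ s = 4π²|m_s|²τ_s`), and a realised weight `ϑ` with the TWO-TERM law `|ϑ(T) − (ϑ∞ − 4/T²)| ≤ 12/T³` for `T ≥ T₀` (ramp `½`: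
`ϑ(½,T) = 1/3 − 4/T² + 12/T³ + O(e^{−T/2})`, the tree's closed form `LatticeShear.mul_integral_trapezoid_duhamel_eq`; the one-term law is
`abs_slotWeight_sub_le`).  With `F₂ q p := Σ_s w s q p / (T₁ s)²` — pointwise POSITIVE on transverse pairs because isotropy makes some slot
active at every pair, hence `inf F₂ > 0` by compactness — and the reciprocal band `lo = a^{-1/2}`, `hi = a^{1/2}`:
`sup_{qp} Σ_s ϑ(T_s·lo) w_s = ϑ∞G₀ − (4a/M²)·inf F₂ + O(M⁻³)` and `inf_{qp} Σ_s ϑ(T_s·hi) w_s = ϑ∞G₀ − (4/(aM²))·sup F₂ + O(M⁻³)`, so the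
realised isotropic gains CROSS (`gainSup(lo) < gainInf(hi)` in the normalisation of `LoewnerWindowSketch.gainForm`) as soon as
`a² · inf F₂ > sup F₂` and `M ≥ M₀(a, data)`.  Then `N·lo·hi = N :=` the midpoint and S3/S3′ (`QSWindow`, `QSWindowPerturbed`) give
`WindowClause (N⁻¹·G) lo hi Λ 0` for every `Λ ≥ 1`.  Cubature word: `a⋆ = √(sup F₂/inf F₂) = 1.21227` (leading order), exact thresholds
`1.21246 / 1.21233 / 1.21229` at `M = 1 / 3 / 10` (k1l3 `qs_pinch_check.py`); at aspect `3/2`, `M = 1` the margin is `3.50·10⁻⁵` of `56`. -/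
def IsoTwoTermThreshold : Prop :=
  ∀ (k : ℕ) (w : Fin k → (Fin 3 → ℝ) → (Fin 3 → ℝ) → ℝ) (T₁ : Fin k → ℝ) (ϑ : ℝ → ℝ) (ϑinf T₀ G₀ : ℝ),
    0 < G₀ → 0 < T₀ → (∀ s, 0 < T₁ s) →
    (∀ s, Continuous (fun qp : (Fin 3 → ℝ) × (Fin 3 → ℝ) => w s qp.1 qp.2)) →
    (∀ s, ∀ qp ∈ transversePairs, 0 ≤ w s qp.1 qp.2) →
    (∀ qp ∈ transversePairs, ∑ s, w s qp.1 qp.2 = G₀) →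
    (∀ T, T₀ ≤ T → |ϑ T - (ϑinf - 4 / T ^ 2)| ≤ 12 / T ^ 3) →
    ∀ a : ℝ, 1 < a →
      sSup ((fun qp : (Fin 3 → ℝ) × (Fin 3 → ℝ) => ∑ s, w s qp.1 qp.2 / T₁ s ^ 2) '' transversePairs) <
        a ^ 2 * sInf ((fun qp : (Fin 3 → ℝ) × (Fin 3 → ℝ) => ∑ s, w s qp.1 qp.2 / T₁ s ^ 2) '' transversePairs) →
      ∃ M₀ : ℝ, 0 < M₀ ∧ ∀ M : ℝ, M₀ ≤ M →
        sSup ((fun qp : (Fin 3 → ℝ) × (Fin 3 → ℝ) => ∑ s, ϑ (M * T₁ s * a ^ (-(1 / 2 : ℝ))) * w s qp.1 qp.2) '' transversePairs) <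
          sInf ((fun qp : (Fin 3 → ℝ) × (Fin 3 → ℝ) => ∑ s, ϑ (M * T₁ s * a ^ (1 / 2 : ℝ)) * w s qp.1 qp.2) '' transversePairs)

/-- **(W-T2′) positivity of `F₂` from isotropy** (S; the remark inside W-T2 isolated as the first landable lemma): a finite family of
non-negative continuous forms with constant positive sum on the compact set of unit transverse pairs has `inf_{qp} Σ_s w_s/(T₁ s)² > 0`. -/
def IsoF2Pos : Prop :=
  ∀ (k : ℕ) (w : Fin k → (Fin 3 → ℝ) → (Fin 3 → ℝ) → ℝ) (T₁ : Fin k → ℝ) (G₀ : ℝ),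
    0 < G₀ → (∀ s, 0 < T₁ s) →
    (∀ s, Continuous (fun qp : (Fin 3 → ℝ) × (Fin 3 → ℝ) => w s qp.1 qp.2)) →
    (∀ s, ∀ qp ∈ transversePairs, 0 ≤ w s qp.1 qp.2) →
    (∀ qp ∈ transversePairs, ∑ s, w s qp.1 qp.2 = G₀) →
    0 < sInf ((fun qp : (Fin 3 → ℝ) × (Fin 3 → ℝ) => ∑ s, w s qp.1 qp.2 / T₁ s ^ 2) '' transversePairs)

/-! ## (V) the averaging lemma behind the error structure of clause (V) -/

/-- **(V-T1) Decay-relative linear averaging** (M; finite-dimensional ODE, Mathlib only).  A linear system `x' = −(Ḡ + g(t))x` on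
`t ≥ 0` in `ℝ^m` with a SYMMETRIC coercive constant part `r_lo|v|² ≤ vᵀḠv ≤ r̄|v|²` (`r̄ ≤ κ r_lo`), a continuous perturbation with
entries `|g_{ij}(t)| ≤ r̄` whose means over the periods `[jP, (j+1)P]` are RELATIVELY `e`-small (`|∫ g_{ij}| ≤ e·r̄·P`), and many periods
per relaxation time (`r̄P ≤ 1`), stays close to the constant-coefficient flow DECAY-RELATIVELY:
`|x(t) − e^{−tḠ}x(0)| ≤ C(m,κ)·(e·min(1, r̄t) + r̄P)·|x(0)|` for all `t ≥ 0` — first-order averaging with exponential stability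
(near-identity transform `y = (1 + ∫(g − ḡ))x`, second-order terms `r̄·(r̄P)` summed over the relaxation time `1/r_lo` give `κ·r̄P`; the
mean drift `ḡ_j`, `|ḡ_j| ≤ e r̄`, shifts the phase by `e r̄ t e^{−r_lo t} ≤ C(κ)·e·min(1, r̄t)`).  In clause (V): `x(t)` = the two transverse
Fourier coefficients of mode `ℓ` of the cell solution (they lie ON the slow graph, `L(0) = 0`), `Ḡ` = `4π²(|ℓ|²/n²)`× the transverse block of
`𝔸 + (c/ν)Φ(𝔸/ν)` at `ℓ̂`, `g` = graph term minus its model, `e = C(ν^σ + (|ℓ|⌈K/ν⌉/n)^σ)`, `r̄ = 8π²|ℓ|²hiΛ(ν + c/ν)/n²`, `P = M·period/ν`,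
and `e^{−tḠ}x(0)` = the mode-`ℓ` coefficient of THE effective solution `v` (`CellLawVNoExSketch.exists_effective_singleMode` + uniqueness);
the a-priori bound `hB` (B = 1) is the PDE energy inequality + Parseval; for `r̄P > 1` the clause's bound then holds trivially with `C ≥ 2`. -/
def DecayRelativeAveragingB : Prop :=
  ∀ (m : ℕ) (κ : ℝ), 1 ≤ κ → ∃ C : ℝ, 0 ≤ C ∧
    ∀ (Gbar : Matrix (Fin m) (Fin m) ℝ) (g : ℝ → Matrix (Fin m) (Fin m) ℝ) (x : ℝ → Fin m → ℝ) (rlo rbar P e B : ℝ),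
      0 < rlo → rlo ≤ rbar → rbar ≤ κ * rlo → 0 < P → rbar * P ≤ 1 → 0 ≤ e → e ≤ 1 → 0 ≤ B →
      Gbar.IsSymm →
      (∀ v : Fin m → ℝ, rlo * ∑ i, v i ^ 2 ≤ ∑ i, ∑ j, v i * Gbar i j * v j) →
      (∀ v : Fin m → ℝ, ∑ i, ∑ j, v i * Gbar i j * v j ≤ rbar * ∑ i, v i ^ 2) →
      Continuous g → (∀ t, 0 ≤ t → ∀ i j, |g t i j| ≤ rbar) →
      (∀ n : ℕ, ∀ i j, |∫ t in ((n:ℝ) * P)..(((n:ℝ) + 1) * P), g t i j| ≤ e * rbar * P) →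
      (∀ t, 0 ≤ t → HasDerivAt x (-((Gbar + g t).mulVec (x t))) t) →
      (∀ t, 0 ≤ t → ∑ i, (x t i) ^ 2 ≤ B ^ 2 * ∑ i, (x 0 i) ^ 2) →
      ∀ t, 0 ≤ t →
        ∑ i, (x t i - (NormedSpace.exp (-(t • Gbar))).mulVec (x 0) i) ^ 2 ≤
          (C * B * (e * min 1 (rbar * t) + rbar * P)) ^ 2 * ∑ i, (x 0) i ^ 2

/- NEGATIVE KNOWLEDGE (ad-ideate-lit g24, FINDING L24-1, 2026-08-28T12:28Z): the v1/v2 statement `DecayRelativeAveraging` — the text above WITHOUT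
   the binder `B` and the a-priori hypothesis `hB : ∀ t ≥ 0, Σ (x t i)² ≤ B²·Σ (x 0 i)²` — is FALSE AS TYPED.  CE-1: m = 2, κ = 1, Ḡ = I, P = 1, e = 1,
   g ≡ [[−1,1],[1,−1]] (|g_ij| ≤ r̄, period means ≤ e·r̄·P), x(t) = eᵗ(1,−1) solves x' = −(Ḡ+g)x and ‖x(t) − e^{−tḠ}x(0)‖² = 2(eᵗ−e^{−t})² → ∞;
   CE-2 (e = 0 exactly, κ > 8): a three-phase cycle of trace-free g with Floquet radius 1.133/period beats r_lo.  Root cause: `|g_ij| ≤ r̄` lets Ḡ + g be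
   indefinite; in clause (V) the missing input is the PDE energy inequality (B = 1: `PassiveVectorTensorEnergyDecay.ae_energy_ineq` + Parseval), hence
   `DecayRelativeAveragingB`.  ad-lit is landing the generic Hilbert-space form as `Literature/Analysis/ODE/LinearPeriodicAveraging.lean` (Besjes / SVM
   Lemma 2.8.2 IBP; C = m(2+(m+2)κ)); V5 then closes BY CITATION. -/

/-! ## v2 (12:21Z, ADDENDUM §7 of the STUB-IDEAS): the ODD CHANNEL — two helper statements for the `β > 0` / reversal variants -/

/-- **W5-core · `OddChannelAMGM` (universal, S-sized)**: for a finite slot family with nonnegative weights `g s` (= `pref_s (e_s·k̂)²`) and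
cosines `μ s` (= `m̂_s·k̂`) with `|μ s| < 1` on every slot of positive weight (a contributing slot has `e_s·k̂ ≠ 0`, hence `m̂_s ≠ ±k̂`), the
odd-channel numerator `Σ g s |μ s|` is STRICTLY below the isotropic normalisation `(Σ g s + Σ g s (μ s)²)/2` (= `c₀P` by isotropy summed over the
two polarisations) as soon as one weight is positive: Cauchy–Schwarz + AM–GM with the strictness from `|μ| < 1`.  This is the `γ_W < 1` half of the
odd-channel contraction `κ_odd(bI) = γ_W/b²`; the aspect condition `a·Λ²·γ_W < 1` is separate (ADDENDUM §7(b)). -/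
def OddChannelAMGM : Prop :=
  ∀ (ι : Type) [Fintype ι] (g μ : ι → ℝ), (∀ s, 0 ≤ g s) → (∀ s, 0 < g s → |μ s| < 1) → (∃ s, 0 < g s) →
    ∑ s, g s * |μ s| < (∑ s, g s + ∑ s, g s * μ s ^ 2) / 2

/-- **`TransposeMonodromyOfReversal` (finite-dimensional REVERSAL LEMMA, S/M-sized)**: a matrix ODE `X' = A(t)·X`, `X(0) = 1`, whose
coefficient is reversal-self-adjoint on `[0, P]`, `A(P − t)ᵀ = A(t)`, has a SYMMETRIC monodromy `X(P)ᵀ = X(P)`.  (Proof: `Φ(t) := (X(P)·X(P−t)⁻¹)ᵀ`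
solves the same initial-value problem; uniqueness.)  Applied to the Leray–Galerkin lattice system of the cell problem — generator
`−a(t)𝒜_W(t) − 𝒟_S` with `𝒜_W` antisymmetric (passive solenoidal vector, `A = 0`) and `𝒟_S` symmetric — the hypothesis says the word is its own
NEGATED PALINDROME (`−W^R ≡ W`), and the conclusion makes the base-mode return block, hence the exact shape map `Φ_ν(S)`, odd-free for every
symmetric `S` (ADDENDUM §7(b); kick-regime toy j308277: odd/sym `≤ 7·10⁻⁸` for `W·(−W^R)` versus `10⁻³` for `W`). -/
def TransposeMonodromyOfReversal : Prop :=
  ∀ (m : ℕ) (A X : ℝ → Matrix (Fin m) (Fin m) ℝ) (P : ℝ), 0 < P → Continuous A →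
    (∀ t ∈ Set.Icc 0 P, (A (P - t))ᵀ = A t) →
    X 0 = 1 → (∀ t ∈ Set.Icc 0 P, HasDerivWithinAt X (A t * X t) (Set.Icc 0 P) t) →
    (X P)ᵀ = X P

/-! ## How the two halves meet the stub text (informal; the typed compositions are the worker's first files)

(W)  `IsoF2Pos` → `IsoTwoTermThreshold` (+ S0 `SlotWeightMono`, S2 `QSPinch` with the full map's relative memory slack
     `η ≤ C_W/T_min³`, S3′ `QSWindowPerturbed`) ⟹ `∃ N lo hi Λ, WindowClause (N⁻¹·G_{W,M}) lo hi Λ 0` for every isotropic `W`, every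
     `M ≥ M₀(W, a)`, every `Λ ≥ 1`: the FIRST conjunct of `stub_cellLawV` with `β = 0`, `c/ν·Φ(𝔸/ν) := N⁻¹·(c/ν)·G_{W,M}(𝔸/ν)` and
     `c := N` (bookkept gain).
(V)  Fourier reduction (every weak solution; `ae_galerkinFlux_eq_sum`, `ae_mode_energy_eq`, uniqueness p607939) → slow/fast split of the
     Bloch sector of `ℓ` (slow = the 2-plane `ℓ^⊥` at `ℓ`; fast = `ℓ + n(Λ_W∖0)`, damping `≥ γ = π²ν·lo/Λ`, couplings `δ = |e·ξ|/(2|m|) ≤ ϖν/2`,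
     `4δ² < γ²` for all `ϖ ≤ 1`) → G1 with `L(0) = 0` + G2 (the datum `Re e_ℓ·p` is on the graph) → the 2×2 slow equation
     `x' = −(A₁₁ + A₁₂L(t))x` → PERIOD-MEAN IDENTIFICATION `(1/P)∫_{period}(A₁₁ + A₁₂L) = Ḡ(1 + O(e))` with
     `Ḡ = 4π²(|ℓ|²/n²)[𝔸 + (c/ν)N⁻¹G_{W,M}(𝔸/ν)]_⊥` (chain sum: non-mixing chains exact = the definition of `G_{W,M}`; Riccati/ladder corrections
     `O(ϖ²)`; mixing chains `≤ e^{−cM}·s(ν)`, `s(ν) ≤ ν^σ` = `ForeignSlotHypocoerciveLadderSketch.FirstLemma`; OFF THE PATH for the cubature crux K1L₀ under the Φ_ν-family typing, R24-1)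
     → `DecayRelativeAveragingB` (hB from the energy inequality) ⟹ `SlowVectorClauseNoEx …` — the SECOND conjunct.
(W5) v3: under the Φ_ν-family typing the odd half of the window is `OddChannelBound` + `oddWindow_of_oddChannelBound` below.
-/

/-! ## v3 (R24-1 follow-up): W5 — the ODD-CHANNEL BOUND, typed, with the reduction to the odd half of the window PROVED

Typing of record after R24-1/D24-2: cubature word `W₀`, Φ_ν family, β-slack.  The odd half of any window clause
(`OddSmall S β → OddSmall (Φν S) β` on the Λ-widened band) follows from a GAIN-PLUS-SOURCE bound with gain `κ < 1` and a ν-uniform source `ε`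
(the reversal-asymmetric mixing returns of the exact `Φ_ν`; `ε = 0` for the limit map `Φ₀ = N⁻¹G_{W₀,M}`, which is exactly odd-free), by choosing
`β ≥ ε/(1 − κ)` — β is existential in the stub and ν-independent, so a ν-uniform `ε` is all that is needed.  NOTE (correction of a tenure footnote,
D24-2 (f)): the cubature word is NOT reversal-symmetric (`W₀ ≠ −W₀^R`; odd/sym = 1e-3 in the kick regime, j308312), so `β = 0` with the exact `Φ_ν`
FAILS for K1L₀ too — the cubature route needs this W5 (absolute currency, aspect condition below) or p4's sectorial guard (aspect-free).

NUMBERS for `Φ₀ = N⁻¹G_{W₀,M}` (CellLawW-Profile.md Part II; j308312 LP-exact, k1l6/gamma_amgm.py): degree −1 homogeneity gives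
`κ(b·I) = γ/b²`, so on the band `[lo/Λ, hi·Λ]`, `lo = a^{-1/2}`: `κ = γ·a·Λ²` (the anisotropic band points stay below the iso-lo value);
`γ_{W₀} = 0.510` (LP over realisable odd inputs; maximiser re-evaluated 0.508), slot-wise triangle/AM–GM certificate `γ_{W₀} ≤ γ_AMGM(W₀) = 0.655`
(sup at `k̂ ≈ (0.899, 0.396, −0.189)`; `OddChannelAMGM` gives `< 1` for every isotropic word but not the value).  WINDOW CONDITION `κ < 1`:
AM–GM certificate ⇒ `a·Λ² < 1.52` (with `a > a⋆ = 1.2123`: e.g. `a = 1.35, Λ ≤ 1.06` — tight: symmetric margin 3e-7/M², a⋆-slack 24 %);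
LP-dual certificate (per net direction an explicit dual vector of the 18-variable LP) ⇒ `a·Λ² < 1.96` (`a = 1.5, Λ ≤ 1.14` — the recommended point).
SECTORIAL currency (p4 amendment 1, scale-invariant Kato sector): gain `= γ` uniformly on the ray, condition `γ_cert < 1` ASPECT-FREE ⇒ the AM–GM
certificate suffices with 34 % room (anisotropic-point check: Part C, kit j308758).

CERTIFICATE PLAN (M-sized each, all over the closed form; no PDE): (C1) parity: `Φ₀(Sᵀ) = Φ₀(S)ᵀ` (matrix functions + congruences), hence
`odd Φ₀(S_e + S_o)` is odd in `S_o` and `even Φ₀` is even in `S_o`; (C2) first-order slot formula: `D_odd Φ₀(S_e)[S_o](k̂) = N⁻¹ Σ_s w_s(k̂;S_e)·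
f_s′-factor·μ_s(k̂)·ω_s(S_o)` with `μ_s = m̂_s·k̂`, `ω_s` = the odd amplitude of `S_o` at direction `m̂_s` (only the axial component along `m̂_s`
survives `P_{m̂}·P_{m̂}`), so `|D_odd Φ₀| ≤ β·N⁻¹ sup_k Σ_s w_s|f_s′||μ_s|` = `γ_AMGM·β` at `S_e = I` up to `O(T⁻¹)`; (C3) the sup over `k̂ ∈ S²`
(and over `S_e` in the band via the explicit `B̂_s`-dependence) by a certified Lipschitz net in rational arithmetic, target `γ_cert = 0.67` (AM–GM) or
`0.52` (LP-dual); (C4) the cubic remainder `|odd Φ₀(S_e+S_o) − D_odd Φ₀[S_o]| ≤ C₃β³` and the even shift `O(β²)` from analyticity of the matrix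
functions on the band (Cauchy estimate) — both irrelevant at the β the clause uses (`β ~ ε/(1−κ)`, ε exponentially small), but they must be typed. -/

open Literature.Analysis.FluidPDE in
/-- **W5 · odd-channel bound (gain κ, source ε) on the Λ-widened reciprocal band** — the typed interface the window's odd half reduces to. -/
def OddChannelBound (Φ : Torus.Visc4 (Fin 3) → Torus.Visc4 (Fin 3)) (lo hi Λ κ ε : ℝ) : Prop :=
  ∀ lam ∈ Set.Icc (1:ℝ) Λ, ∀ S : Torus.Visc4 (Fin 3), ∀ β : ℝ, 0 ≤ β →
    Torus.NearIso S (lo / lam) (hi * lam) → Torus.OddSmall S β → Torus.OddSmall (Φ S) (κ * β + ε)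

open Literature.Analysis.FluidPDE in
/-- The odd half of `WindowClause Φ lo hi Λ β` from `OddChannelBound` and the slack inequality `κβ + ε ≤ β` (i.e. `β ≥ ε/(1−κ)` when `κ < 1`).
PROVED (it is `OddSmall.mono`). -/
theorem oddWindow_of_oddChannelBound {Φ : Torus.Visc4 (Fin 3) → Torus.Visc4 (Fin 3)} {lo hi Λ κ ε β : ℝ}
    (h : OddChannelBound Φ lo hi Λ κ ε) (hκ : 0 ≤ κ) (hε : 0 ≤ ε) (hβ : 0 ≤ β) (hslack : κ * β + ε ≤ β) :
    ∀ lam ∈ Set.Icc (1:ℝ) Λ, ∀ S : Torus.Visc4 (Fin 3),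
      Torus.OddSmall S β → Torus.NearIso S (lo / lam) (hi * lam) → Torus.OddSmall (Φ S) β := by
  intro lam hlam S hodd hnear
  exact (h lam hlam S β hβ hnear hodd).mono (by positivity) hslack

open Literature.Analysis.FluidPDE in
/-- Family form (Φ_ν typing): a ν-UNIFORM source bound is what makes one β work for all ν.  PROVED. -/
theorem oddWindow_family_of_oddChannelBound {ι : Type*} {Φν : ι → Torus.Visc4 (Fin 3) → Torus.Visc4 (Fin 3)} {lo hi Λ κ εstar β : ℝ}
    {ε : ι → ℝ} (h : ∀ ν, OddChannelBound (Φν ν) lo hi Λ κ (ε ν)) (hκ : 0 ≤ κ) (hε : ∀ ν, 0 ≤ ε ν) (hεle : ∀ ν, ε ν ≤ εstar)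
    (hβ : 0 ≤ β) (hslack : κ * β + εstar ≤ β) :
    ∀ ν, ∀ lam ∈ Set.Icc (1:ℝ) Λ, ∀ S : Torus.Visc4 (Fin 3),
      Torus.OddSmall S β → Torus.NearIso S (lo / lam) (hi * lam) → Torus.OddSmall (Φν ν S) β := by
  intro ν lam hlam S hodd hnear
  exact (h ν lam hlam S β hβ hnear hodd).mono (by have := hε ν; positivity) (by have := hεle ν; linarith)

/-- **W5-num · the cubature odd-channel gain (target of the certificate plan; informal constants in the docstring above)**: for the limit map
`Φ₀ = N⁻¹G_{W₀,M}` of the (W) half — to be DEFINED by the W-worker as an explicit `Torus.Visc4 (Fin 3) → Torus.Visc4 (Fin 3)` — and the reciprocal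
band of aspect `a`, `OddChannelBound Φ₀ a^{-1/2} a^{1/2} Λ (γ·a·Λ²·(1 + δ_M) + C₃β₀²) 0` restricted to `β ≤ β₀`, with a CERTIFIED `γ ≤ 0.67`
(AM–GM route) and `δ_M = O(T_min⁻¹)`.  Stated abstractly over `Φ₀` and the constants so that it can be instantiated the moment `Φ₀` is a tree object. -/
def OddChannelGainCubature (Φ₀ : Literature.Analysis.FluidPDE.Torus.Visc4 (Fin 3) → Literature.Analysis.FluidPDE.Torus.Visc4 (Fin 3))
    (a Λ γ δ C₃ β₀ : ℝ) : Prop :=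
  1 < a ∧ 1 ≤ Λ ∧ 0 ≤ γ ∧ 0 ≤ δ ∧ 0 ≤ C₃ ∧ 0 < β₀ ∧
  ∀ lam ∈ Set.Icc (1:ℝ) Λ, ∀ S : Literature.Analysis.FluidPDE.Torus.Visc4 (Fin 3), ∀ β : ℝ, 0 ≤ β → β ≤ β₀ →
    Literature.Analysis.FluidPDE.Torus.NearIso S (a ^ (-(1/2:ℝ)) / lam) (a ^ (1/2:ℝ) * lam) →
    Literature.Analysis.FluidPDE.Torus.OddSmall S β →
    Literature.Analysis.FluidPDE.Torus.OddSmall (Φ₀ S) ((γ * a * Λ ^ 2 * (1 + δ) + C₃ * β₀ ^ 2) * β)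

end

end Summit.AnomalousDissipation.AnomalousDissipation.Cruxes.LagrangianRenormalisationStep.CellLawVPlan
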